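import Summits.Ventures.CertifiedManyBodySolver.Rows.CARPolyWindowGramContract
import HarnessLib

/-!
# Contracted Gram with the copy lists DERIVED by the kernel: the exporter lists only the PAIRS (per word `a`, its partners `b`);
# `ks := copies(a) ∩ copies(b)` is computed from the word table, so VALIDITY is automatic and the pair data shrinks ≈ ÷4

HONEST FRAMING: Lean plumbing towards «tier P», companion of `Rows/CARPolyWindowGramContract.lean` (HOME/STATUS «(R0′) RESOLVED» 23:33:13Z,
the flagged byte budget): `pairsOf words Q` turns a partner table `Q : List (ℕ × List ℕ)` into the pair list `P` of the companion with
`ks = interKs words a b` (the copies containing both words, read off the memberships); `validP_pairsOf` proves `ValidP` from the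
range check `rangeB` alone, so an instance proves `rangeB`, `sortedB`, `countB` by `decide` and gets `termOp_gramContract` /
`termOp_flatten_gramContractSlices`. Nothing of record moves; CONTROL/CALIBRATION context (wording (xx1)); no summit statement is proved by
this file. Seat hubbard-obs-p2 (STIFFNESS), `prover-hubbard-obs-p2-g23-0`, zero compute.

References: X. Han, arXiv:2006.06002 §2 eq. (2), §3 [Han2020Bootstrap]; J. Wang et al., PRX 14 (2024) 031006 §III [WangEtAl2024].
-/

namespace Summit.Ventures.CertifiedManyBodySolver

namespace CARPolyWindow

open Summit.Ventures.CertifiedQuantumChemistry Summit.Ventures.CertifiedQuantumChemistry.CARPoly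

section Pairs

variable {α : Type*}

/-- The copies containing both words (in the order of `a`'s memberships). [folklore] -/
def interKs (words : WordTable α) (a b : ℕ) : List ℕ :=
  (membOf words a).filterMap fun e => if inCopy words b e.1 then some e.1 else none

/-- The pair list of a partner table, with derived copy lists. [cite: Han2020Bootstrap, §3] -/
def pairsOf (words : WordTable α) (Q : List (ℕ × List ℕ)) : List (ℕ × ℕ × List ℕ) :=
  Q.flatMap fun e => e.2.map fun b => (e.1, b, interKs words e.1 b)

/-- Range check of a partner table against `W` words and `Kc` copies (the copies come from the table, so only their range is checked).
[folklore] -/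
def rangeB (words : WordTable α) (Kc : ℕ) (Q : List (ℕ × List ℕ)) : Bool :=
  Q.all fun e => decide (e.1 < words.length) && (e.2.all fun b => decide (b < words.length)) &&
    ((membOf words e.1).all fun m => decide (m.1 < Kc))

/-- A derived copy contains both words. [folklore] -/
theorem mem_interKs {words : WordTable α} {a b k : ℕ} (h : k ∈ interKs words a b) :
    inCopy words a k = true ∧ inCopy words b k = true ∧ ∃ m ∈ membOf words a, m.1 = k := by
  rw [interKs, List.mem_filterMap] at h
  obtain ⟨m, hm, hk⟩ := h
  split_ifs at hk with hb
  · simp only [Option.some.injEq] at hk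
    subst hk
    refine ⟨?_, hb, m, hm, rfl⟩
    rw [inCopy, List.any_eq_true]
    exact ⟨m, hm, by simp⟩

/-- **Validity is automatic for derived copy lists** (given the range check). [folklore] -/
theorem validP_pairsOf (words : WordTable α) (Kc : ℕ) (Q : List (ℕ × List ℕ)) (h : rangeB words Kc Q = true) :
    ValidP words Kc (pairsOf words Q) := by
  intro t ht
  rw [incid, List.mem_flatMap] at ht
  obtain ⟨e, he, hte⟩ := ht
  rw [pairsOf, List.mem_flatMap] at he
  obtain ⟨q, hq, heq⟩ := he
  rw [List.mem_map] at heq hte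
  obtain ⟨b, hb, rfl⟩ := heq
  obtain ⟨k, hk, rfl⟩ := hte
  simp only [rangeB, List.all_eq_true, Bool.and_eq_true, decide_eq_true_eq] at h
  obtain ⟨⟨ha, hbs⟩, hks⟩ := h q hq
  obtain ⟨hia, hib, m, hm, hmk⟩ := mem_interKs hk
  exact ⟨ha, hbs b hb, hmk ▸ hks m hm, hia, hib⟩

end Pairs

end CARPolyWindow

end Summit.Ventures.CertifiedManyBodySolver
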